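import Summits.AtomisticToContinuum.FouriersLaw.Theses.NoHiddenChargesKubo
import Literature.Barriers.AtomisticToContinuum.MazurBoundBallisticNarrow

/-!
# Crux `NoOddDrudeWeight` (stmt-AtomisticToContinuum-17667) — skeleton line `conserved-space-is-even`

BC3 birth skeleton filed by the crux-strategist of the parity split of `ChargeCompleteness`
(route `NoHiddenChargesKubo`). Two registered stubs and the kernel-checked composition
`NoOddDrudeWeight_of : NoOddDrudeWeight` (the two stubs invoked BY NAME inside the proof; no other hypothesis).

* `stub_representation` (shared with the `EvenChargeCompleteness` skeleton; analytic, L-sized, believed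
  PROVABLE from the clauses by the GNS / Kolmogorov dilation — in tree as
  `Literature.MathematicalPhysics.KineticTheory.FluctuationSpace` / `ZeroWavenumberSpace`): every
  symmetric set-up `(μ, D)` with the `GibbsClustering` clauses is REPRESENTED on a real Hilbert space
  `E` by a strongly continuous contraction semigroup `U` (the Koopman group of `φ`), a linear isometry
  `R` (momentum reversal) and a class map `ι` on `LocObs`, with the full dictionary
  `⟪U t (ι f), ι g⟫ = Σ_x Cov(f∘φ_t, g∘shift^x)` (`t ≥ 0`), `⟪ι f, ι g⟫ = Σ_x Cov(f, g∘shift^x)`,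
  `R (ι f) = ι (f ∘ R)`, homogeneity of `ι`, and density of `span ι(LocObs)` (so the representation is
  unique up to unitary equivalence: the ∀-quantified core stub below is representation-independent).
* `stub_conservedEven` (THE CORE, open): in every such representation the conserved space
  `{v | U t v = v, t ≥ 0}` (Doyon's `𝒬₀`) is pointwise FIXED by `R` — "every pseudolocal conserved
  quantity of the pinned anharmonic chain at wavenumber 0 is momentum-even". Implied by
  `LocalChargeClassification ∧ ChargeCompleteness` (then `𝒬₀ = ℝ·[e₀]`), but it is a statement about
  `𝒬₀` only, reachable by rigidity / ergodicity arguments that never classify local charges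
  (CurrentTiltQuench's regular-state engine generalised from the clipped current to all odd `LocObs`).
* Composition: for odd `f`, `R (ι f) = ι (f∘R) = ι (−f) = −ι f`; the in-tree PARITY CRITERION
  `Mazur.tendsto_inv_mul_integral_inner_zero_of_reversing` (a reversing isometry fixing the conserved
  vectors kills Suzuki's limit) gives `τ⁻¹∫₀^τ ⟪U t ι f, ι f⟫ → 0`, and the dictionary turns the
  integrand into `K_f(t)` on `[0, τ]`.
-/

noncomputable section

namespace Summit.AtomisticToContinuum.FouriersLaw.Cruxes.NoOddDrudeWeight.ConservedSpaceIsEven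

open Filter Set Function MeasureTheory
open scoped Topology BigOperators InnerProductSpace
open Literature.MathematicalPhysics.KineticTheory.HeatConduction
open Summit.AtomisticToContinuum.FouriersLaw.Theses.NoHiddenChargesKubo
open Literature.Barriers.AtomisticToContinuum

/-- stub (REPRESENTATION / GNS dictionary of a symmetric set-up; shared with the EvenChargeCompleteness
skeleton). -/
theorem stub_representation :
    ∀ ω₂ lam β γ : ℝ, 0 < ω₂ → 0 < lam → 0 < β → ∀ T : ℝ, 0 < T → ∀ μ : MeasureTheory.Measure Literature.MathematicalPhysics.KineticTheory.HeatConduction.ChainConfig, (Literature.MathematicalPhysics.KineticTheory.HeatConduction.pinnedChain ω₂ lam β γ).IsChainGibbsMeasure T μ → Literature.MathematicalPhysics.KineticTheory.HeatConduction.IsShiftInvariant μ → μ.map (fun σ : Literature.MathematicalPhysics.KineticTheory.HeatConduction.ChainConfig => fun x : ℤ => ((σ x).1, -(σ x).2)) = μ → ∀ D : Literature.MathematicalPhysics.KineticTheory.HeatConduction.InfiniteChainDynamics (Literature.MathematicalPhysics.KineticTheory.HeatConduction.pinnedChain ω₂ lam β γ), D.PreservesMeasure μ → (∀ t : ℝ,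 ∀ᵐ σ ∂μ, D.flow t (Literature.MathematicalPhysics.KineticTheory.HeatConduction.shift σ) = Literature.MathematicalPhysics.KineticTheory.HeatConduction.shift (D.flow t σ)) → let LocObs : (Literature.MathematicalPhysics.KineticTheory.HeatConduction.ChainConfig → ℝ) → Prop := fun f => ∃ (a : ℤ) (n : ℕ) (g : (Fin (n + 1) → ℝ × ℝ) → ℝ), Continuous g ∧ (∃ (C : ℝ) (k : ℕ), ∀ v, |g v| ≤ C * (1 + ‖v‖) ^ k) ∧ ∀ σ, f σ = g (Literature.MathematicalPhysics.KineticTheory.HeatConduction.boxRestrictAt a n σ); let Cov : (Literature.MathematicalPhysics.KineticTheory.HeatConduction.ChainConfig → ℝ) → (Literature.MathematicalPhysics.KineticTheory.HeatConduction.ChainConfig → ℝ) → ℝ → ℤ → ℝ := fun f g t x => MeasureTheory.integral μ (fun σ => f (D.flow t σ) * g (fun y => σ (y + x))) - MeasureTheory.integral μ (fun σ => f (D.flow t σ)) * MeasureTheory.integral μ (fun σ => g (fun y => σ (y + x))); (∀ f g : Literature.MathematicalPhysics.KineticTheory.HeatConduction.ChainConfig → ℝ, LocObs f → LocObs g → (∀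 (t : ℝ) (x : ℤ), MeasureTheory.Integrable (fun σ => f (D.flow t σ) * g (fun y => σ (y + x))) μ) ∧ (∀ t₀ : ℝ, ∃ m : ℤ → ℝ, Summable m ∧ ∀ t ∈ Set.Icc (0 : ℝ) t₀, ∀ x : ℤ, |Cov f g t x| ≤ m x) ∧ (∀ x : ℤ, Continuous (fun t : ℝ => Cov f g t x)) ∧ Continuous (fun t : ℝ => ∑' x : ℤ, Cov f g t x)) → ∃ (E : Type) (_ : NormedAddCommGroup E) (_ : InnerProductSpace ℝ E) (_ : CompleteSpace E) (U : ℝ → E →L[ℝ] E) (R : E →ₗᵢ[ℝ] E) (ι : (Literature.MathematicalPhysics.KineticTheory.HeatConduction.ChainConfig → ℝ) → E), Literature.Barriers.AtomisticToContinuum.Mazur.IsContractionSemigroup U ∧ (∀ f g : Literature.MathematicalPhysics.KineticTheory.HeatConduction.ChainConfig → ℝ, LocObs f → LocObs g → ∀ t : ℝ, 0 ≤ t → ⟪U t (ι f), ι g⟫_ℝ = ∑' x : ℤ, Cov f g t x) ∧ (∀ f g : Literature.MathematicalPhysics.KineticTheory.HeatConduction.ChainConfig → ℝ, LocObs f → LocObs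 g → ⟪ι f, ι g⟫_ℝ = ∑' x : ℤ, Cov f g 0 x) ∧ (∀ f : Literature.MathematicalPhysics.KineticTheory.HeatConduction.ChainConfig → ℝ, LocObs f → R (ι f) = ι (fun σ => f (fun x : ℤ => ((σ x).1, -(σ x).2)))) ∧ (∀ f : Literature.MathematicalPhysics.KineticTheory.HeatConduction.ChainConfig → ℝ, LocObs f → ∀ c : ℝ, ι (fun σ => c * f σ) = c • ι f) ∧ Dense ((Submodule.span ℝ (ι '' {f | LocObs f}) : Submodule ℝ E) : Set E) := by
  sorry

/-- stub (THE CORE: the conserved space at wavenumber 0 is momentum-even). -/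
theorem stub_conservedEven :
    ∀ ω₂ lam β γ : ℝ, 0 < ω₂ → 0 < lam → 0 < β → ∀ T : ℝ, 0 < T → ∀ μ : MeasureTheory.Measure Literature.MathematicalPhysics.KineticTheory.HeatConduction.ChainConfig, (Literature.MathematicalPhysics.KineticTheory.HeatConduction.pinnedChain ω₂ lam β γ).IsChainGibbsMeasure T μ → Literature.MathematicalPhysics.KineticTheory.HeatConduction.IsShiftInvariant μ → μ.map (fun σ : Literature.MathematicalPhysics.KineticTheory.HeatConduction.ChainConfig => fun x : ℤ => ((σ x).1, -(σ x).2)) = μ → ∀ D : Literature.MathematicalPhysics.KineticTheory.HeatConduction.InfiniteChainDynamics (Literature.MathematicalPhysics.KineticTheory.HeatConduction.pinnedChain ω₂ lam β γ), D.PreservesMeasure μ → (∀ t : ℝ, ∀ᵐ σ ∂μ, D.flow t (Literature.MathematicalPhysics.KineticTheory.HeatConduction.shift σ) = Literature.MathematicalPhysics.KineticTheory.HeatConduction.shift (D.flow t σ)) → let LocObs : (Literature.MathematicalPhysics.KineticTheory.HeatConduction.ChainConfig → ℝ) → Prop := fun f => ∃ (a : ℤ) (n : ℕ) (g : (Fin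 (n + 1) → ℝ × ℝ) → ℝ), Continuous g ∧ (∃ (C : ℝ) (k : ℕ), ∀ v, |g v| ≤ C * (1 + ‖v‖) ^ k) ∧ ∀ σ, f σ = g (Literature.MathematicalPhysics.KineticTheory.HeatConduction.boxRestrictAt a n σ); let Cov : (Literature.MathematicalPhysics.KineticTheory.HeatConduction.ChainConfig → ℝ) → (Literature.MathematicalPhysics.KineticTheory.HeatConduction.ChainConfig → ℝ) → ℝ → ℤ → ℝ := fun f g t x => MeasureTheory.integral μ (fun σ => f (D.flow t σ) * g (fun y => σ (y + x))) - MeasureTheory.integral μ (fun σ => f (D.flow t σ)) * MeasureTheory.integral μ (fun σ => g (fun y => σ (y + x))); (∀ f g : Literature.MathematicalPhysics.KineticTheory.HeatConduction.ChainConfig → ℝ, LocObs f → LocObs g → (∀ (t : ℝ) (x : ℤ), MeasureTheory.Integrable (fun σ => f (D.flow t σ) * g (fun y => σ (y + x))) μ) ∧ (∀ t₀ : ℝ, ∃ m : ℤ → ℝ, Summable m ∧ ∀ t ∈ Set.Icc (0 : ℝ) t₀, ∀ x : ℤ, |Cov f g t x| ≤ m x) ∧ (∀ x : ℤ, Continuous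 (fun t : ℝ => Cov f g t x)) ∧ Continuous (fun t : ℝ => ∑' x : ℤ, Cov f g t x)) → ∀ (E : Type) [NormedAddCommGroup E] [InnerProductSpace ℝ E] [CompleteSpace E] (U : ℝ → E →L[ℝ] E) (R : E →ₗᵢ[ℝ] E) (ι : (Literature.MathematicalPhysics.KineticTheory.HeatConduction.ChainConfig → ℝ) → E), Literature.Barriers.AtomisticToContinuum.Mazur.IsContractionSemigroup U → (∀ f g : Literature.MathematicalPhysics.KineticTheory.HeatConduction.ChainConfig → ℝ, LocObs f → LocObs g → ∀ t : ℝ, 0 ≤ t → ⟪U t (ι f), ι g⟫_ℝ = ∑' x : ℤ, Cov f g t x) → (∀ f g : Literature.MathematicalPhysics.KineticTheory.HeatConduction.ChainConfig → ℝ, LocObs f → LocObs g → ⟪ι f, ι g⟫_ℝ = ∑' x : ℤ, Cov f g 0 x) → (∀ f : Literature.MathematicalPhysics.KineticTheory.HeatConduction.ChainConfig → ℝ, LocObs f → R (ι f) = ι (fun σ => f (fun x : ℤ => ((σ x).1, -(σ x).2)))) → (∀ f : Literature.MathematicalPhysics.KineticTheory.HeatConduction.ChainConfig → ℝ, LocObs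 f → ∀ c : ℝ, ι (fun σ => c * f σ) = c • ι f) → Dense ((Submodule.span ℝ (ι '' {f | LocObs f}) : Submodule ℝ E) : Set E) → ∀ v ∈ Literature.Barriers.AtomisticToContinuum.Mazur.invariantSubspace U, R v = v := by
  sorry

/-- **Composition**: representation + evenness of the conserved space ⇒ `NoOddDrudeWeight`, via the
in-tree parity criterion `Mazur.tendsto_inv_mul_integral_inner_zero_of_reversing`. [folklore] -/
theorem NoOddDrudeWeight_of : NoOddDrudeWeight := by
  have hRep := stub_representation
  have hCE := stub_conservedEven
  intro ω₂ lam β γ hω hl hβ T hT μ hμG hμS hμR D hD hcomm LocObs Cov hcl f hf hodd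
  obtain ⟨E, i1, i2, i3, U, R, ι, hU, hdyn, hstat, hR, hlin, hdense⟩ :=
    hRep ω₂ lam β γ hω hl hβ T hT μ hμG hμS hμR D hD hcomm hcl
  have hfix : ∀ v ∈ Mazur.invariantSubspace U, R v = v :=
    hCE ω₂ lam β γ hω hl hβ T hT μ hμG hμS hμR D hD hcomm hcl E U R ι hU hdyn hstat hR hlin hdense
  have hRA : R (ι f) = -(ι f) := by
    rw [hR f hf]
    have hfun : (fun σ : ChainConfig => f (fun x : ℤ => ((σ x).1, -(σ x).2))) =
        fun σ => (-1) * f σ := by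
      funext σ
      rw [hodd σ]
      ring
    rw [hfun, hlin f hf (-1), neg_one_smul]
  have hlim := Mazur.tendsto_inv_mul_integral_inner_zero_of_reversing hU R (ι f) hRA hfix
  refine hlim.congr' ?_
  filter_upwards [eventually_ge_atTop (0 : ℝ)] with τ hτ
  congr 1
  apply intervalIntegral.integral_congr
  intro t ht
  rw [Set.uIcc_of_le hτ] at ht
  exact hdyn f f hf hf t ht.1

end Summit.AtomisticToContinuum.FouriersLaw.Cruxes.NoOddDrudeWeight.ConservedSpaceIsEven

end
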